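import Summits.BirchSwinnertonDyer.BirchSwinnertonDyer.Theorems.GenusKolyvaginAtTwoKolyvaginExactAtTwoPosDiscTOfPowDvd
import Summits.BirchSwinnertonDyer.BirchSwinnertonDyer.Theorems.GenusKolyvaginAtTwoPowDvdShaCardAtTwoPosT
import HarnessLib

/-!
# Route `GenusKolyvaginAtTwo` — THE CRUX Q4_T″ `KolyvaginExactAtTwoPosDiscT` (stmt-BirchSwinnertonDyer-25502, rev 48) BY NAME:
# `#Ш(E/K)[2^∞] = 2^(2M₀)` on the Δ>0 cut with a transposition-deep Kolyvagin witness = glue 23380 ∘ U⁺_T′ (25500) ∘ L⁺_T′ (25501)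

Seat `bsd-line-gk2-p2` g22 (cell `bsd-f1-sign2`), `--workitem stmt-BirchSwinnertonDyer-25502`; file = the LEAD gk2-p1 g20's TEMPLATE (HOME
`line23378/KolyvaginExactAtTwoPosDiscT_TEMPLATE.lean`) with the L⁺_T′ closer's module filled in.  THEOREMS ONLY; no `sorry`.  **BSD is NOT proved by this**;
neither is the route's deciding theorem (supply⁺ 25504, the Δ<0 supply 23491 and Q2 24880 remain open; everything here is modulo the antecedent Q2).

Composition: LEAD's reducer `kolyvaginExactAtTwoPosDiscT_of_powDvdShaCardAtTwoPosT` (p759566 = glue `kolyvaginExactAtTwoPosDiscTOfHalves_proof` p757700 ∘ U⁺_T′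
`shaCardDvdPowAtTwoPosT_proof` p757977) applied to this seat's L⁺_T′ closer `powDvdShaCardAtTwoPosT_proof` (road (E4)⁺).
References: [McCallumLMS1991] §5 Thm. 5.4, Cor. 5.6; [Kolyvagin1991StructureSha]; [GrossLMS1991] §10.
-/

set_option autoImplicit false
-- the Theorems namespace of this sub repeats the summit name by design (D-0017 nested layout)
set_option linter.dupNamespace false

namespace Summit.BirchSwinnertonDyer.BirchSwinnertonDyer.Theorems

open Summit.BirchSwinnertonDyer.BirchSwinnertonDyer.Theses.GenusKolyvaginAtTwo

/-- **Q4_T″ `KolyvaginExactAtTwoPosDiscT` (stmt-BirchSwinnertonDyer-25502) BY NAME** = glue (p757700) ∘ U⁺_T′ (p757977) ∘ L⁺_T′ (`powDvdShaCardAtTwoPosT_proof`, road (E4)⁺):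
on the Δ>0 cut of the habitat with a transposition-deep Kolyvagin witness, `#Ш(E/K)[2^∞] = 2^(2M₀)` (modulo the antecedent Q2).  BSD is NOT proved by this.
[cite: McCallumLMS1991, §5 Thm. 5.4, Cor. 5.6] [cite: Kolyvagin1991StructureSha] -/
theorem kolyvaginExactAtTwoPosDiscT_proof : KolyvaginExactAtTwoPosDiscT :=
  kolyvaginExactAtTwoPosDiscT_of_powDvdShaCardAtTwoPosT powDvdShaCardAtTwoPosT_proof

end Summit.BirchSwinnertonDyer.BirchSwinnertonDyer.Theorems
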